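/-
Copyright (c) 2026 the pub-hodgecm-mathlib formalisation cell (harness21).  Prover seat hodgecm-mathlib-LH4-p19 (g0), req620 Track A «(D-RAM) FOUR-FRAME» squad
(STAGE-1b, row (2) of the piece `f_{T₊}`, the (β₂) road (R-36) «PURE-CELL LEDGER»; β₂ sub-dealer LH4-p04 (g8) BETA2-BOARD v1.1 row (L-D×); heir LEAD F0P3a-plan (g21)
T20-19 «RELATIVE SIGNS»: the rows carry a δ-regime), 2026-09-04.
-/
import Summits.HodgeConjecture.HodgeConjecture.Theorems.F0P3cDyRamFourFramePieces      -- ★ №3 DEFS `mstarOfRecord` (the level of record `m* = d % 2 + 2d − 1`)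
import Literature.NumberTheory.Automorphic.UnitaryThreeFourFrameDefs                   -- ★ `IsRamifiedQuadraticDatum`
import Literature.NumberTheory.LocalFields.QuadraticOrderIntegralBasis                  -- ★ T4 `mem_order_iff_exists` (`z ∈ 𝒪_E + c𝒪_M ⟺ z = a + c·y`); brings ★ `WildQuadraticEisensteinFrame` (`exists_fixed_coords_of_map_ne`, `v_fixed_add_fixed_mul_eq_max`)
import Literature.NumberTheory.LocalFields.WildQuadraticDatumTrace                     -- ★ `v_add_map_le_exp` (`Tr 𝔭^j ⊆ 𝔭^{2⌊(j+d)∕2⌋}`), `v_varpi_pow`, `even_log_v_of_fixed`, `sub_map_ne_zero`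
import HarnessLib

/-!
# Crux `H413`, line LH4 «(D-RAM) FOUR-FRAME» — STAGE-1b, row (2), the (β₂) road (R-36), row (L-D×): «THE CLEAN REGIME OF THE DIAGONAL CELL» — the regime letter
# `hlam : |lam − jE u₀₀ + jE(f·t₊·(ϖσϖ)^b)| ≤ |jEϖ|^{2b+m*}` of ★ `F0P3cDyRamDiagonalCellLetter` HOLDS for some `σ`-fixed unit `f` as soon as `d` is EVEN and
# `min(2b, δ) ≥ m* + d − 1` (`2b = m = v(lam − jE u₀₀)`, `δ = jλ − m` the eigenvalue gap; `m* + d − 1 = 3d − 2`)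

Cell `hodgecm-mathlib` (D-0151), FLOOR 0, crux item H413 = `stmt-HodgeConjecture-24833`, route of record `HCCMUnconditional`; squad F0∕P3c∕LH4; lane
`--supports stmt-HodgeConjecture-24833 --as helper` (count-neutral; pays NO tier-0 row).  THEOREMS ONLY (no `def`, no instance, no notation, no `sorry`, default heartbeats);
★-only imports; states NO law; (β₂) stays a HYPOTHESIS.  DATUM-FREE local algebra: a wild ramified quadratic datum `IsRamifiedQuadraticDatum σ ϖ d t` on the plane field `E`
(§1–§3) and ★ (C1)∕★ T4's line-model letters `(M, jE, ρ; α)` (§4–§6); no residue field, no lattices.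

WHY (★ p861637 `…DiagonalCellLetter` + ★ p861633 `…DiagonalCellCrossLiteral`, this seat; LH4-cdis1 (g0) 15:32:52Z: D antisymmetric-pure at δ ≥ 4, balanced at δ = 2, mixed and
literal-symmetric at δ = 0, U-keys d = 2).  The (L-D×) HEAD reads the letter of a diagonal-cell vertex as `valueSetMod σ ϖ m* ((f·h_W) • X₊)` under the CLEAN LETTER `hlam` —
`μ := lam − jE u₀₀ ≡ −jE(f·t₊·(ϖσϖ)^b)` modulo `𝔭^{2b+m*}` with `f` a `σ`-FIXED UNIT, `t₊ = (ϖ − σϖ)((ϖσϖ)^{(d − d%2)∕2})⁻¹` ★ №3's reference skew scalar.  THIS FILE derives `hlam`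
from the two DEPTHS of the sub-dealer's (R-sp) spelling (`hm : |μ| = |jEϖ|^{2b}`, `hjl : |μ − ρμ| ≤ |jEϖ|^{2b+δ}·|α − ρα|`) and the torus equations `Θ(lam)·lam = 1`, `u₀₀·σu₀₀ = 1`:
* §1 `exists_fixed_unit_sub_mul_refSkew_le` (E-side, `d` EVEN): a unit `t₀` with DEEP TRACE `|t₀ + σt₀| ≤ |ϖ|^{3d−2}` is `≡ f·t₊ (mod 𝔭^{m*})` for a `σ`-fixed unit `f`
  (Eisenstein coordinates ★ `exists_fixed_coords_of_map_ne`: `t₀∕t₊ = x₁ + y₁ϖ`, `|y₁|·|ϖ|^d = |Tr t₀|`, `f := x₁`).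
* §2 `v_add_map_le_of_norm_near_one` (E-side): `u·σu = 1`, `|u − 1| ≤ |ϖ|^{m*}`, `|μ_E| ≤ |ϖ|^{2b}`, `|N(u + μ_E) − 1| ≤ |ϖ|^{2b+δ}`, `m* + d − 1 ≤ 2b, δ` ⟹
  `|μ_E + σμ_E| ≤ |ϖ|^{2b + m* + d − 1}` (`Tr(μ_E·σu) = N(u + μ_E) − 1 − N(μ_E)`; `Tr((1 − σu)·μ_E)` by the trace ideal ★ `v_add_map_le_exp`).
* §3 `exists_fixed_unit_hlamE` (E-side, `d` even): §2 ∘ §1 at `t₀ = −μ_E∕(ϖσϖ)^b` ⟹ `∃ f, σf = f ∧ |f| = 1 ∧ |μ_E + f·t₊·(ϖσϖ)^b| ≤ |ϖ|^{2b+m*}`.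
* §4 `v_map_le_pow_iff`, `v_eq_pow_of_map_eq` (depth transfer along `jE`), `exists_eq_pow_mul_map_add` (M-side, ★ T4 letters `hρρ hα hα1 hint hjfix`): `|μ| ≤ |ϖE|^n`, `|μ − ρμ| ≤ |ϖE^{n+δ}(α − ρα)|` ⟹ `μ = jE μ_E + ϖE^{n+δ}·y` (★
  `mem_order_iff_exists` at conductor `ϖE^δ` applied to `μ∕ϖE^n`) — the E-APPROXIMANT of the depth multiplier (LH4-p16 (g0) MECH-D «μ̃ = e + ϖE^δ z»).
* §5 `v_map_norm_sub_one_le` (M-side): `Θ(lam)·lam = 1`, `|lam − jE x| ≤ C ≤ 1`, `|lam| = 1` ⟹ `|jE(x·σx) − 1| ≤ C`.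
* §6 HEAD `exists_fixed_unit_hlam_of_depths` — everything assembled: at a datum with `d` even, `Θ(lam)·lam = 1`, `u₀₀σu₀₀ = 1`, `|u₀₀ − 1| ≤ |ϖ|^{m*}`, `|μ| = |jEϖ|^{2b}`,
  `|μ − ρμ| ≤ |jEϖ^{2b+δ}·(α − ρα)|`, `m* + d − 1 ≤ 2b`, `m* + d − 1 ≤ δ`: **`∃ f, σ f = f ∧ |f| = 1 ∧ |μ + jE(f·t₊·(ϖσϖ)^b)| ≤ |jEϖ|^{2b + m*}`** — the `hlam`∕`hft` letters of
  ★ `valueSet_endoGL_sub_one_glued_eq_smul_xPlus_of_diag(_of_datum)` and the `hσf hf1` letters of ★ `eq_plus_iff_not_eq_plus_of_lineEntries`, with ONE `f` for both literals.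
So the (L-D×) definer in the LEAD's δ-language is «`d` even ∧ `m ≥ 3d − 2` ∧ `δ ≥ 3d − 2`» (d = 2: `m, δ ≥ 4` — the engine's boundary between «δ ≥ 4 antisymmetric» and «δ = 2
balanced» EXACTLY); at `d` odd the diagonal cell is off the depth-`ℓ₀ = 1` shell (its values are units, `t₊ ∈ 𝔭`), `hlam` is unsatisfiable and the row is vacuous there.
HONEST LABEL.  Count-neutral local algebra; nothing printed is asserted; no census law is stated; `HC_CM` is proved only modulo the 7 printed citations (2 remaining named inputs:
hLiu418 = `stmt-HodgeConjecture-24832`, h413 = `stmt-HodgeConjecture-24833`) until rung 0 closes.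
## References
* [Serre1979] J.-P. Serre, *Local Fields*, GTM 67 (1979): Ch. I §6 Prop. 18 (`𝒪_E = 𝒪_F[ϖ]`), Ch. III §3 Prop. 7 (trace ideals), Ch. III §6 Prop. 12 (orders), Ch. V §3 Cor. 3.
* [Jacobowitz1962] R. Jacobowitz, *Hermitian forms over local fields*, Amer. J. Math. 84 (1962): §4.
* [Rogawski1990] J. D. Rogawski, *Automorphic Representations of Unitary Groups in Three Variables*, Ann. of Math. Stud. 123 (1990): §4.9 Prop. 4.9.1 (b) p. 55, §12.2.
* [LanglandsShelstad1987] R. P. Langlands, D. Shelstad, *On the definition of transfer factors*, Math. Ann. 278 (1987): §1–§3.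
-/

set_option autoImplicit false

noncomputable section

namespace Summit.HodgeConjecture.HodgeConjecture.Cruxes.H413.F0P3cDyRamDiagonalCellCleanRegime

open scoped Valued WithZero
open WithZero
open Literature.NumberTheory.Automorphic.UnitaryThreeFourFrame (IsRamifiedQuadraticDatum)
open Literature.NumberTheory.LocalFields (exists_fixed_coords_of_map_ne v_fixed_add_fixed_mul_eq_max)
open Literature.NumberTheory.LocalFields.WildQuadraticDatum (v_add_map_le_exp v_varpi_pow even_log_v_of_fixed sub_map_ne_zero)
open Literature.NumberTheory.LocalFields.QuadraticOrder (mem_order_iff_exists)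
open Summit.HodgeConjecture.HodgeConjecture.Cruxes.H413.F0P3cDyRamFourFramePieces (mstarOfRecord)

/-! ## §1 E-side, `d` even: a unit with deep trace is `≡ f·t₊ (mod 𝔭^{m*})` for a `σ`-fixed unit `f` -/

section ESide

variable {K : Type} [Field K] [Valued K ℤᵐ⁰] {σ : K →+* K} {ϖ : K} {d t : ℕ}

/-- `|ϖ|^a ≤ |ϖ|^b` for `b ≤ a` at a datum (`|ϖ| = exp(−1) ≤ 1`). [cite: Serre1979, Ch. III §3 Prop. 7] -/
theorem v_varpi_pow_le_pow (hϖ : Valued.v ϖ = exp (-1 : ℤ)) {a b : ℕ} (hba : b ≤ a) : Valued.v ϖ ^ a ≤ Valued.v ϖ ^ b := by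
  rw [v_varpi_pow hϖ, v_varpi_pow hϖ, exp_le_exp]; omega

/-- **THE REFERENCE SKEW SCALAR AT `d` EVEN IS A `σ`-ANTI-FIXED UNIT**: `t₊ = (ϖ − σϖ)((ϖσϖ)^{(d − d%2)∕2})⁻¹` has `σ t₊ = −t₊` and, when `d % 2 = 0`, `|t₊| = 1`
(`|ϖ − σϖ| = |ϖ|^d`, `|ϖσϖ| = |ϖ|²`). [cite: Serre1979, Ch. I §6 Prop. 18] -/
theorem refSkew_map_and_v (hD : IsRamifiedQuadraticDatum σ ϖ d t) (hd2 : d % 2 = 0) :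
    σ ((ϖ - σ ϖ) * ((ϖ * σ ϖ) ^ ((d - d % 2) / 2))⁻¹) = -((ϖ - σ ϖ) * ((ϖ * σ ϖ) ^ ((d - d % 2) / 2))⁻¹) ∧
      Valued.v ((ϖ - σ ϖ) * ((ϖ * σ ϖ) ^ ((d - d % 2) / 2))⁻¹) = 1 := by
  obtain ⟨hσσ, hvσ, hϖ, -, hdd, -, -⟩ := hD
  refine ⟨?_, ?_⟩
  · rw [map_mul, map_inv₀, map_pow, map_mul, map_sub, hσσ, mul_comm (σ ϖ) ϖ]; ring
  · have hd' : 2 * ((d - d % 2) / 2) = d := by omega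
    rw [Valuation.map_mul, map_inv₀, Valuation.map_pow, Valuation.map_mul, hvσ, ← pow_two, ← pow_mul, hd', hdd]
    have h0 : Valued.v ϖ ^ d ≠ 0 := pow_ne_zero _ (by rw [hϖ]; exact exp_ne_zero)
    exact mul_inv_cancel₀ h0

/-- **A UNIT WITH DEEP TRACE IS A `σ`-FIXED UNIT TIMES `t₊`, MODULO `𝔭^{m*}`** (`d` even, `m* = mstarOfRecord d = 2d − 1`).  For `|t₀| = 1` with `|t₀ + σt₀| ≤ |ϖ|^{3d−2}`
there is a `σ`-fixed unit `f` with `|t₀ − f·t₊| ≤ |ϖ|^{m*}`: in the Eisenstein coordinates `t₀∕t₊ = x₁ + y₁·ϖ` (★ `exists_fixed_coords_of_map_ne`; `x₁, y₁` fixed) one has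
`t₀∕t₊ − σ(t₀∕t₊) = (t₀ + σt₀)∕t₊ = y₁(ϖ − σϖ)`, so `|y₁| ≤ |ϖ|^{2d−2}`, `|x₁| = 1` (★ `v_fixed_add_fixed_mul_eq_max`), and `f := x₁` has `t₀ − f·t₊ = y₁·ϖ·t₊`.
[cite: Serre1979, Ch. I §6 Prop. 18] [cite: Serre1979, Ch. III §3 Prop. 7] -/
theorem exists_fixed_unit_sub_mul_refSkew_le (hD : IsRamifiedQuadraticDatum σ ϖ d t) (hd2 : d % 2 = 0)
    {t₀ : K} (ht₀ : Valued.v t₀ = 1) (htr : Valued.v (t₀ + σ t₀) ≤ Valued.v ϖ ^ (3 * d - 2)) :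
    ∃ f : K, σ f = f ∧ Valued.v f = 1 ∧
      Valued.v (t₀ - f * ((ϖ - σ ϖ) * ((ϖ * σ ϖ) ^ ((d - d % 2) / 2))⁻¹)) ≤ Valued.v ϖ ^ mstarOfRecord d := by
  obtain ⟨hσt, hvt⟩ := refSkew_map_and_v hD hd2
  obtain ⟨hσσ, hvσ, hϖ, hfix, hdd, hd1, -⟩ := hD
  set tp : K := (ϖ - σ ϖ) * ((ϖ * σ ϖ) ^ ((d - d % 2) / 2))⁻¹ with htp
  have htp0 : tp ≠ 0 := fun h0 => by rw [h0, map_zero] at hvt; exact zero_ne_one hvt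
  have hϖσ : σ ϖ ≠ ϖ := fun h => sub_map_ne_zero hϖ hdd (by rw [h, sub_self])
  have hfix' : ∀ c : K, σ c = c → c ≠ 0 → Even (log (Valued.v c)) := fun c hc hc0 => even_log_v_of_fixed hfix c hc hc0
  -- Eisenstein coordinates of `τ = t₀ / t₊`
  obtain ⟨x₁, y₁, hx₁, hy₁, hτ⟩ := exists_fixed_coords_of_map_ne hσσ hϖσ (t₀ / tp)
  have hvτ : Valued.v (t₀ / tp) = 1 := by rw [map_div₀, ht₀, hvt, div_one]
  -- `τ − στ = y₁ (ϖ − σϖ)` and `τ − στ = (t₀ + σ t₀)/t₊`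
  have hdiff : t₀ / tp - σ (t₀ / tp) = y₁ * (ϖ - σ ϖ) := by
    conv_lhs => rw [hτ, map_add, map_mul, hx₁, hy₁]
    ring
  have hdiff' : t₀ / tp - σ (t₀ / tp) = (t₀ + σ t₀) / tp := by
    rw [map_div₀, hσt]; field_simp; ring
  have hvy₁ : Valued.v y₁ ≤ Valued.v ϖ ^ (2 * d - 2) := by
    have h1 : Valued.v (y₁ * (ϖ - σ ϖ)) ≤ Valued.v ϖ ^ (3 * d - 2) := by
      rw [← hdiff, hdiff', map_div₀, hvt, div_one]; exact htr
    rw [Valuation.map_mul, hdd] at h1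
    have h0 : Valued.v ϖ ^ d ≠ 0 := pow_ne_zero _ (by rw [hϖ]; exact exp_ne_zero)
    have h2 : Valued.v ϖ ^ (3 * d - 2) = Valued.v ϖ ^ (2 * d - 2) * Valued.v ϖ ^ d := by rw [← pow_add]; congr 1; omega
    rw [h2] at h1
    exact le_of_mul_le_mul_right h1 (zero_lt_iff.2 h0)
  have hvx₁ : Valued.v x₁ = 1 := by
    have hmax := v_fixed_add_fixed_mul_eq_max hfix' hϖ hx₁ hy₁
    rw [← hτ, hvτ] at hmax
    have hlt : Valued.v y₁ * exp (-1 : ℤ) < 1 := by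
      have hy1 : Valued.v y₁ ≤ 1 := hvy₁.trans (pow_le_one' (by rw [hϖ, ← exp_zero, exp_le_exp]; norm_num) _)
      calc Valued.v y₁ * exp (-1 : ℤ) ≤ 1 * exp (-1 : ℤ) := by gcongr
        _ < 1 := by rw [one_mul, ← exp_zero, exp_lt_exp]; norm_num
    rcases le_total (Valued.v x₁) (Valued.v y₁ * exp (-1 : ℤ)) with h | h
    · rw [max_eq_right h] at hmax; exact absurd hmax.symm (ne_of_lt hlt)
    · rw [max_eq_left h] at hmax; exact hmax.symm
  refine ⟨x₁, hx₁, hvx₁, ?_⟩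
  have hrem : t₀ - x₁ * tp = y₁ * ϖ * tp := by
    have : t₀ = (t₀ / tp) * tp := by rw [div_mul_cancel₀ t₀ htp0]
    rw [this, hτ]; ring
  rw [hrem, Valuation.map_mul, Valuation.map_mul, hvt, mul_one]
  have hm : mstarOfRecord d = (2 * d - 2) + 1 := by simp only [mstarOfRecord]; omega
  rw [hm, pow_add, pow_one]
  gcongr

/-! ## §2 E-side: the trace of the E-approximant is deep when the norm equation holds to depth `2b + δ` -/

/-- **DEEP TRACE FROM THE NORM EQUATION.**  At a datum, for `u` with `u·σu = 1`, `|u − 1| ≤ |ϖ|^{m*}` and `μ_E` with `|μ_E| ≤ |ϖ|^{2b}`, `|N(u + μ_E) − 1| ≤ |ϖ|^{2b+δ}`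
(`N x = x·σx`), if `m* + d − 1 ≤ 2b` and `m* + d − 1 ≤ δ` then `|μ_E + σμ_E| ≤ |ϖ|^{2b + (m* + d − 1)}`:  `μ_E = μ_E·σu + μ_E·(1 − σu)` with
`Tr(μ_E·σu) = N(u + μ_E) − 1 − N(μ_E)` and `|Tr(μ_E(1 − σu))| ≤ |ϖ|^{2⌊(2b + m* + d)∕2⌋}` (★ `v_add_map_le_exp`). [cite: Serre1979, Ch. III §3 Prop. 7] [cite: Serre1979, Ch. V §3 Cor. 3] -/
theorem v_add_map_le_of_norm_near_one (hD : IsRamifiedQuadraticDatum σ ϖ d t) {u μE : K} {b δ : ℕ}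
    (huu : u * σ u = 1) (hu1 : Valued.v (u - 1) ≤ Valued.v ϖ ^ mstarOfRecord d) (hμE : Valued.v μE ≤ Valued.v ϖ ^ (2 * b))
    (hN : Valued.v ((u + μE) * σ (u + μE) - 1) ≤ Valued.v ϖ ^ (2 * b + δ))
    (hb : mstarOfRecord d + d - 1 ≤ 2 * b) (hδ : mstarOfRecord d + d - 1 ≤ δ) :
    Valued.v (μE + σ μE) ≤ Valued.v ϖ ^ (2 * b + (mstarOfRecord d + d - 1)) := by
  obtain ⟨hσσ, hvσ, hϖ, hfix, hdd, hd1, ht⟩ := hD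
  set K₀ : ℕ := mstarOfRecord d + d - 1 with hK₀
  have hσu : σ u - 1 = σ (u - 1) := by rw [map_sub, map_one]
  -- the two pieces of `μE`
  have hsplit : μE + σ μE = (μE * σ u + σ (μE * σ u)) + (μE * (1 - σ u) + σ (μE * (1 - σ u))) := by
    rw [map_mul, map_mul, hσσ, map_sub, map_one, hσσ]; ring
  have hA : μE * σ u + σ (μE * σ u) = ((u + μE) * σ (u + μE) - 1) - μE * σ μE := by
    rw [map_mul, hσσ, map_add]
    linear_combination -huu
  rw [hsplit]
  refine (Valuation.map_add _ _ _).trans (max_le ?_ ?_)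
  · rw [hA]
    refine (Valuation.map_sub _ _ _).trans (max_le (hN.trans (v_varpi_pow_le_pow hϖ (by omega))) ?_)
    rw [Valuation.map_mul, hvσ]
    calc Valued.v μE * Valued.v μE ≤ Valued.v ϖ ^ (2 * b) * Valued.v ϖ ^ (2 * b) := by gcongr
      _ = Valued.v ϖ ^ (2 * b + 2 * b) := by rw [pow_add]
      _ ≤ Valued.v ϖ ^ (2 * b + K₀) := v_varpi_pow_le_pow hϖ (by omega)
  · -- trace ideal: `|μE (1 − σu)| ≤ |ϖ|^{2b + m*}`, so its trace is `≤ exp(−2m'')` for `2m'' ≤ 2b + m* + d`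
    have hx : Valued.v (μE * (1 - σ u)) ≤ exp (-((2 * b + mstarOfRecord d : ℕ) : ℤ)) := by
      have h1u : Valued.v (1 - σ u) ≤ Valued.v ϖ ^ mstarOfRecord d := by
        rw [← Valuation.map_neg, neg_sub, hσu, hvσ]; exact hu1
      rw [← v_varpi_pow hϖ, Valuation.map_mul, pow_add]
      gcongr
    have hK₀even : (2 * b + K₀) % 2 = 0 := by simp only [hK₀, mstarOfRecord]; omega
    have h1 := v_add_map_le_exp hσσ hfix hϖ hdd ht (x := μE * (1 - σ u)) (j := ((2 * b + mstarOfRecord d : ℕ) : ℤ))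
      (m := (((2 * b + K₀) / 2 : ℕ) : ℤ)) hx (by simp only [hK₀, mstarOfRecord] at *; push_cast; omega)
    rw [v_varpi_pow hϖ]
    refine h1.trans (exp_le_exp.2 ?_)
    omega

/-! ## §3 E-side, `d` even: the clean letter on `E` -/

/-- **THE CLEAN LETTER ON `E`** (`d` even): under §2's hypotheses with `|μ_E| = |ϖ|^{2b}` EXACTLY, there is a `σ`-fixed unit `f` with `|μ_E + f·t₊·(ϖσϖ)^b| ≤ |ϖ|^{2b + m*}`
(§1 at `t₀ = −μ_E∕(ϖσϖ)^b`, a unit with `|Tr t₀| = |Tr μ_E|·|ϖ|^{−2b} ≤ |ϖ|^{3d−2}`). [cite: Serre1979, Ch. I §6 Prop. 18] [cite: Serre1979, Ch. III §3 Prop. 7] -/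
theorem exists_fixed_unit_hlamE (hD : IsRamifiedQuadraticDatum σ ϖ d t) (hd2 : d % 2 = 0) {u μE : K} {b δ : ℕ}
    (huu : u * σ u = 1) (hu1 : Valued.v (u - 1) ≤ Valued.v ϖ ^ mstarOfRecord d) (hμE : Valued.v μE = Valued.v ϖ ^ (2 * b))
    (hN : Valued.v ((u + μE) * σ (u + μE) - 1) ≤ Valued.v ϖ ^ (2 * b + δ))
    (hb : mstarOfRecord d + d - 1 ≤ 2 * b) (hδ : mstarOfRecord d + d - 1 ≤ δ) :
    ∃ f : K, σ f = f ∧ Valued.v f = 1 ∧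
      Valued.v (μE + f * ((ϖ - σ ϖ) * ((ϖ * σ ϖ) ^ ((d - d % 2) / 2))⁻¹) * (ϖ * σ ϖ) ^ b) ≤ Valued.v ϖ ^ (2 * b + mstarOfRecord d) := by
  have htrμ := v_add_map_le_of_norm_near_one hD huu hu1 (le_of_eq hμE) hN hb hδ
  have hσσ := hD.1
  have hvσ := hD.2.1
  have hϖ := hD.2.2.1
  have hvϖ0 : Valued.v ϖ ≠ 0 := by rw [hϖ]; exact exp_ne_zero
  have hϖ0 : ϖ ≠ 0 := fun h0 => by rw [h0, map_zero] at hvϖ0; exact hvϖ0 rfl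
  have hP0 : (ϖ * σ ϖ) ^ b ≠ 0 := pow_ne_zero _ (mul_ne_zero hϖ0 ((map_ne_zero σ).2 hϖ0))
  have hvP : Valued.v ((ϖ * σ ϖ) ^ b) = Valued.v ϖ ^ (2 * b) := by
    rw [Valuation.map_pow, Valuation.map_mul, hvσ, ← pow_two, ← pow_mul, mul_comm]
  have hσP : σ ((ϖ * σ ϖ) ^ b) = (ϖ * σ ϖ) ^ b := by rw [map_pow, map_mul, hσσ, mul_comm]
  set t₀ : K := -(μE / (ϖ * σ ϖ) ^ b) with ht₀def
  have ht₀ : Valued.v t₀ = 1 := by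
    rw [ht₀def, Valuation.map_neg, map_div₀, hμE, hvP, div_self (pow_ne_zero _ hvϖ0)]
  have htr : Valued.v (t₀ + σ t₀) ≤ Valued.v ϖ ^ (3 * d - 2) := by
    have h1 : t₀ + σ t₀ = -((μE + σ μE) / (ϖ * σ ϖ) ^ b) := by rw [ht₀def, map_neg, map_div₀, hσP]; ring
    rw [h1, Valuation.map_neg, map_div₀, hvP]
    have h0 : (0 : ℤᵐ⁰) < Valued.v ϖ ^ (2 * b) := zero_lt_iff.2 (pow_ne_zero _ hvϖ0)
    rw [div_le_iff₀ h0, ← pow_add]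
    refine htrμ.trans (v_varpi_pow_le_pow hϖ ?_)
    simp only [mstarOfRecord]; omega
  obtain ⟨f, hσf, hf1, hfle⟩ := exists_fixed_unit_sub_mul_refSkew_le hD hd2 ht₀ htr
  refine ⟨f, hσf, hf1, ?_⟩
  have hrew : μE + f * ((ϖ - σ ϖ) * ((ϖ * σ ϖ) ^ ((d - d % 2) / 2))⁻¹) * (ϖ * σ ϖ) ^ b =
      -((ϖ * σ ϖ) ^ b) * (t₀ - f * ((ϖ - σ ϖ) * ((ϖ * σ ϖ) ^ ((d - d % 2) / 2))⁻¹)) := by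
    rw [ht₀def]; field_simp; ring
  rw [hrew, Valuation.map_mul, Valuation.map_neg, hvP, pow_add]
  gcongr

end ESide

/-! ## §4 M-side: the E-approximant of the depth multiplier (★ T4 `mem_order_iff_exists`) -/

section MSide

variable {E M : Type} [Field E] [Valued E ℤᵐ⁰] [Field M] [Valued M ℤᵐ⁰] {ρ Θ : M →+* M} {α : M}

/-- **TRANSFER OF DEPTH BOUNDS ALONG `jE`**: `|jE c| ≤ |jE ϖ|^n ↔ |c| ≤ |ϖ|^n` (from `|jE c| ≤ 1 ↔ |c| ≤ 1` applied to `c ∕ ϖ^n`). [cite: Serre1979, Ch. III §6 Prop. 12] -/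
theorem v_map_le_pow_iff (jE : E →+* M) (hjv : ∀ c, Valued.v (jE c) ≤ 1 ↔ Valued.v c ≤ 1) {ϖ : E} (hϖ0 : ϖ ≠ 0) (c : E) (n : ℕ) :
    Valued.v (jE c) ≤ Valued.v (jE ϖ) ^ n ↔ Valued.v c ≤ Valued.v ϖ ^ n := by
  have hϖn0 : ϖ ^ n ≠ 0 := pow_ne_zero _ hϖ0
  have hvE : (0 : ℤᵐ⁰) < Valued.v (ϖ ^ n) := zero_lt_iff.2 ((Valuation.ne_zero_iff _).2 hϖn0)
  have hvM : (0 : ℤᵐ⁰) < Valued.v (jE (ϖ ^ n)) := zero_lt_iff.2 ((Valuation.ne_zero_iff _).2 ((map_ne_zero jE).2 hϖn0))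
  have key := hjv (c / ϖ ^ n)
  rw [map_div₀, map_div₀, map_div₀, div_le_one₀ hvM, div_le_one₀ hvE, Valuation.map_pow, map_pow, Valuation.map_pow] at key
  exact key

/-- `|jE c| = |jE ϖ|^n → |c| = |ϖ|^n` (both inequalities through `v_map_le_pow_iff`, the reverse one on `c⁻¹`). [cite: Serre1979, Ch. III §6 Prop. 12] -/
theorem v_eq_pow_of_map_eq (jE : E →+* M) (hjv : ∀ c, Valued.v (jE c) ≤ 1 ↔ Valued.v c ≤ 1) {ϖ : E} (hϖ0 : ϖ ≠ 0) {c : E} {n : ℕ}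
    (h : Valued.v (jE c) = Valued.v (jE ϖ) ^ n) : Valued.v c = Valued.v ϖ ^ n := by
  have hϖn0 : ϖ ^ n ≠ 0 := pow_ne_zero _ hϖ0
  have hc0 : c ≠ 0 := fun h0 => by
    rw [h0, map_zero, Valuation.map_zero] at h
    exact (pow_ne_zero n ((Valuation.ne_zero_iff _).2 ((map_ne_zero jE).2 hϖ0))) h.symm
  refine le_antisymm ((v_map_le_pow_iff jE hjv hϖ0 c n).1 h.le) ?_
  -- the reverse inequality: `|ϖ^n / c| ≤ 1`
  have h1 : Valued.v (jE (ϖ ^ n / c)) ≤ 1 := by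
    rw [map_div₀, map_pow, Valuation.map_div, Valuation.map_pow, ← h, div_self ((Valuation.ne_zero_iff _).2 ((map_ne_zero jE).2 hc0))]
  have h2 := (hjv _).1 h1
  rw [Valuation.map_div, Valuation.map_pow, div_le_one₀ (zero_lt_iff.2 ((Valuation.ne_zero_iff _).2 hc0))] at h2
  exact h2

omit [Valued E ℤᵐ⁰] in
/-- **THE E-APPROXIMANT OF THE DEPTH MULTIPLIER** (★ T4's integral-basis letters `hρρ hα hα1 hint`, `ρ`-fixed = `jE(E)` via `hjfix`, `ϖE` a `ρ`-fixed integer): if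
`|μ| ≤ |ϖE|^n` and `|μ − ρμ| ≤ |ϖE^{n+δ}·(α − ρα)|` then `μ = ϖE^n·jE e + ϖE^{n+δ}·y` with `|jE e|, |y| ≤ 1` — `μ∕ϖE^n` lies in the order of conductor `ϖE^δ` (★
`mem_order_iff_exists`).  The sub-dealer's (R-sp) depths `hm`, `hjl` (`|α − ρα| = 1` in the RamK block) are exactly these two letters at `n = m`.
[cite: Serre1979, Ch. III §6 Prop. 12] [cite: Jacobowitz1962, §4] -/
theorem exists_eq_pow_mul_map_add (hρρ : ∀ x, ρ (ρ x) = x) (hα : ρ α ≠ α) (hα1 : Valued.v α ≤ 1)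
    (hint : ∀ z : M, Valued.v z ≤ 1 → Valued.v ((z - ρ z) / (α - ρ α)) ≤ 1)
    (jE : E →+* M) (hjfix : ∀ z, ρ z = z ↔ ∃ c, jE c = z) {ϖE : M} (hρϖ : ρ ϖE = ϖE) (hϖE0 : ϖE ≠ 0) (hϖE1 : Valued.v ϖE ≤ 1)
    {μ : M} {n δ : ℕ} (hμ : Valued.v μ ≤ Valued.v ϖE ^ n) (hμρ : Valued.v (μ - ρ μ) ≤ Valued.v (ϖE ^ (n + δ) * (α - ρ α))) :
    ∃ (e : E) (y : M), Valued.v (jE e) ≤ 1 ∧ Valued.v y ≤ 1 ∧ μ = ϖE ^ n * jE e + ϖE ^ (n + δ) * y := by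
  have hPn0 : ϖE ^ n ≠ 0 := pow_ne_zero _ hϖE0
  have hvPn : (0 : ℤᵐ⁰) < Valued.v (ϖE ^ n) := zero_lt_iff.2 ((Valuation.ne_zero_iff _).2 hPn0)
  set z : M := μ / ϖE ^ n with hz
  have hz1 : Valued.v z ≤ 1 := by
    rw [hz, map_div₀, div_le_one₀ hvPn, Valuation.map_pow]; exact hμ
  have hzρ : Valued.v (z - ρ z) ≤ Valued.v (ϖE ^ δ * (α - ρ α)) := by
    have h1 : z - ρ z = (μ - ρ μ) / ϖE ^ n := by rw [hz, map_div₀, map_pow, hρϖ]; ring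
    rw [h1, map_div₀, div_le_iff₀ hvPn, ← Valuation.map_mul]
    have h2 : ϖE ^ δ * (α - ρ α) * ϖE ^ n = ϖE ^ (n + δ) * (α - ρ α) := by ring
    rw [h2]; exact hμρ
  obtain ⟨a, y, ha, ha1, hy1, hzay⟩ := (mem_order_iff_exists hρρ hα hα1 hint (c := ϖE ^ δ) (by rw [map_pow, hρϖ]) (pow_ne_zero _ hϖE0)
    (by rw [Valuation.map_pow]; exact pow_le_one' hϖE1 _) z).1 ⟨hz1, hzρ⟩
  obtain ⟨e, he⟩ := (hjfix a).1 ha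
  refine ⟨e, y, by rw [he]; exact ha1, hy1, ?_⟩
  have : μ = ϖE ^ n * z := by rw [hz, mul_div_cancel₀ μ hPn0]
  rw [this, hzay, he]; ring

/-! ## §5 M-side: the norm equation from `Θ(lam)·lam = 1` -/

omit [Valued E ℤᵐ⁰] in
/-- **THE NORM EQUATION TO DEPTH `C`**: if `Θ(lam)·lam = 1`, `|lam| = 1`, `Θ ∘ jE = jE ∘ σ`, `Θ` isometric and `|lam − jE x| ≤ C ≤ 1`, then `|jE(x·σx) − 1| ≤ C`
(`jE(xσx) = (lam − θ)·Θ(lam − θ)`, `θ = lam − jE x`). [cite: Jacobowitz1962, §4] -/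
theorem v_map_norm_sub_one_le (σ : E →+* E) (jE : E →+* M) (hΘj : ∀ c, Θ (jE c) = jE (σ c)) (hvΘ : ∀ x, Valued.v (Θ x) = Valued.v x)
    {lam : M} (hΘlam : Θ lam * lam = 1) (hlam1 : Valued.v lam = 1) {x : E} {C : ℤᵐ⁰} (hC : C ≤ 1) (hx : Valued.v (lam - jE x) ≤ C) :
    Valued.v (jE (x * σ x) - 1) ≤ C := by
  set θ : M := lam - jE x with hθ
  have hjx : jE x = lam - θ := by rw [hθ]; ring
  have hkey : jE (x * σ x) - 1 = -(lam * Θ θ) + (-(θ * Θ lam) + θ * Θ θ) := by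
    rw [map_mul, ← hΘj, hjx, map_sub]
    linear_combination hΘlam
  rw [hkey]
  have hvθ : Valued.v θ ≤ C := hx
  refine (Valuation.map_add _ _ _).trans (max_le ?_ ((Valuation.map_add _ _ _).trans (max_le ?_ ?_)))
  · rw [Valuation.map_neg, Valuation.map_mul, hlam1, one_mul, hvΘ]; exact hvθ
  · rw [Valuation.map_neg, Valuation.map_mul, hvΘ, hlam1, mul_one]; exact hvθ
  · rw [Valuation.map_mul, hvΘ]
    calc Valued.v θ * Valued.v θ ≤ C * 1 := by gcongr; exact hvθ.trans hC
      _ = C := mul_one C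

/-! ## §6 HEAD — the clean letter of (L-D×) from the depths -/

/-- **HEAD — «THE CLEAN REGIME OF THE DIAGONAL CELL»: `d` EVEN, `m ≥ m* + d − 1`, `δ ≥ m* + d − 1` ⟹ `∃ f`, `σ f = f`, `|f| = 1`,
`|lam − jE u₀₀ + jE(f·t₊·(ϖσϖ)^b)| ≤ |jEϖ|^{2b + m*}`** — the `hlam`∕`hft` letters of ★ p861637 `valueSet_endoGL_sub_one_glued_eq_smul_xPlus_of_diag(_of_datum)` and the
`hσf`∕`hf1` letters of ★ p861633 `eq_plus_iff_not_eq_plus_of_lineEntries`, with ONE `f` serving both literals.  Letters: a sheet datum `IsRamifiedQuadraticDatum σ ϖ d t` on `E` with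
`d % 2 = 0`; ★ T4's line-model letters (`ρ` involutive with integral power basis `hα hα1 hint`, `jE(E) = Fix ρ`, `Θ ∘ jE = jE ∘ σ`, `Θ` isometric, `|jE c| ≤ 1 ↔ |c| ≤ 1`); the torus
equations `Θ(lam)·lam = 1`, `|lam| = 1`, `u₀₀·σu₀₀ = 1`, `|u₀₀ − 1| ≤ |ϖ|^{m*}`; the (R-sp) DEPTHS of `μ = lam − jE u₀₀`: `|μ| = |jEϖ|^{2b}` and `|μ − ρμ| ≤ |jEϖ^{2b+δ}·(α − ρα)|`.
At `d = 2` the threshold `m* + d − 1 = 3d − 2` reads `m, δ ≥ 4` (the engine's «δ ≥ 4 antisymmetric ∕ δ = 2 balanced» boundary, LH4-cdis1 15:32:52Z).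
[cite: Serre1979, Ch. III §6 Prop. 12] [cite: Serre1979, Ch. III §3 Prop. 7] [cite: Jacobowitz1962, §4] [cite: Rogawski1990, §4.9 Prop. 4.9.1 (b) p. 55] [cite: LanglandsShelstad1987, §1–§3] -/
theorem exists_fixed_unit_hlam_of_depths {σ : E →+* E} {ϖ : E} {d t : ℕ} (hD : IsRamifiedQuadraticDatum σ ϖ d t) (hd2 : d % 2 = 0)
    (hρρ : ∀ x, ρ (ρ x) = x) (hα : ρ α ≠ α) (hα1 : Valued.v α ≤ 1) (hint : ∀ z : M, Valued.v z ≤ 1 → Valued.v ((z - ρ z) / (α - ρ α)) ≤ 1)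
    (jE : E →+* M) (hjv : ∀ c, Valued.v (jE c) ≤ 1 ↔ Valued.v c ≤ 1) (hjfix : ∀ z, ρ z = z ↔ ∃ c, jE c = z)
    (hΘj : ∀ c, Θ (jE c) = jE (σ c)) (hvΘ : ∀ x, Valued.v (Θ x) = Valued.v x)
    {lam : M} (hΘlam : Θ lam * lam = 1) (hlam1 : Valued.v lam = 1)
    {u : E} (huu : u * σ u = 1) (hu1 : Valued.v (u - 1) ≤ Valued.v ϖ ^ mstarOfRecord d)
    {b δ : ℕ} (hm : Valued.v (lam - jE u) = Valued.v (jE ϖ) ^ (2 * b))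
    (hjl : Valued.v ((lam - jE u) - ρ (lam - jE u)) ≤ Valued.v (jE ϖ ^ (2 * b + δ) * (α - ρ α)))
    (hb : mstarOfRecord d + d - 1 ≤ 2 * b) (hδ : mstarOfRecord d + d - 1 ≤ δ) :
    ∃ f : E, σ f = f ∧ Valued.v f = 1 ∧
      Valued.v (lam - jE u + jE (f * ((ϖ - σ ϖ) * ((ϖ * σ ϖ) ^ ((d - d % 2) / 2))⁻¹) * (ϖ * σ ϖ) ^ b)) ≤ Valued.v (jE ϖ) ^ (2 * b + mstarOfRecord d) := by
  have hϖ := hD.2.2.1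
  have hd1 : 1 ≤ d := hD.2.2.2.2.2.1
  have hvϖ0 : Valued.v ϖ ≠ 0 := by rw [hϖ]; exact exp_ne_zero
  have hϖ0 : ϖ ≠ 0 := fun h0 => by rw [h0, map_zero] at hvϖ0; exact hvϖ0 rfl
  have hπ0 : jE ϖ ≠ 0 := (map_ne_zero jE).2 hϖ0
  have hπ1 : Valued.v (jE ϖ) ≤ 1 := (hjv ϖ).2 (by rw [hϖ, ← exp_zero, exp_le_exp]; norm_num)
  have hρπ : ρ (jE ϖ) = jE ϖ := (hjfix _).2 ⟨ϖ, rfl⟩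
  have hδ1 : 1 ≤ δ := by simp only [mstarOfRecord] at hδ; omega
  have hδm : mstarOfRecord d ≤ δ := by omega
  set μ : M := lam - jE u with hμdef
  -- §4: the E-approximant
  obtain ⟨e, y, he1, hy1, hμey⟩ := exists_eq_pow_mul_map_add hρρ hα hα1 hint jE hjfix hρπ hπ0 hπ1 hm.le hjl
  set μE : E := ϖ ^ (2 * b) * e with hμEdef
  have hjμE : jE μE = jE ϖ ^ (2 * b) * jE e := by rw [hμEdef, map_mul, map_pow]
  have hθ : μ - jE μE = jE ϖ ^ (2 * b + δ) * y := by rw [hμey, hjμE]; ring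
  have hvθ : Valued.v (μ - jE μE) ≤ Valued.v (jE ϖ) ^ (2 * b + δ) := by
    rw [hθ, Valuation.map_mul, Valuation.map_pow]
    calc Valued.v (jE ϖ) ^ (2 * b + δ) * Valued.v y ≤ Valued.v (jE ϖ) ^ (2 * b + δ) * 1 := by gcongr
      _ = _ := mul_one _
  -- `|μE| = |ϖ|^{2b}` exactly (the tail is strictly deeper)
  have hπlt : Valued.v (jE ϖ) < 1 := by
    refine lt_of_le_of_ne hπ1 fun h1 => ?_
    have h0 := v_eq_pow_of_map_eq jE hjv hϖ0 (c := ϖ) (n := 0) (by rw [pow_zero, h1])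
    rw [pow_zero, hϖ, ← exp_zero] at h0
    exact absurd (exp_injective h0) (by norm_num)
  have hvμE : Valued.v μE = Valued.v ϖ ^ (2 * b) := by
    refine v_eq_pow_of_map_eq jE hjv hϖ0 ?_
    have hlt : Valued.v (-(μ - jE μE)) < Valued.v μ := by
      rw [Valuation.map_neg, hm]
      refine lt_of_le_of_lt hvθ ?_
      exact pow_lt_pow_right_of_lt_one₀ (zero_lt_iff.2 ((Valuation.ne_zero_iff _).2 hπ0)) hπlt (by omega)
    have h2 : jE μE = μ + -(μ - jE μE) := by ring
    rw [h2, Valuation.map_add_eq_of_lt_left _ hlt, hm]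
  -- §5: the norm equation for `x = u + μE`
  have hxθ : Valued.v (lam - jE (u + μE)) ≤ Valued.v (jE ϖ) ^ (2 * b + δ) := by
    have : lam - jE (u + μE) = μ - jE μE := by rw [hμdef, map_add]; ring
    rw [this]; exact hvθ
  have hN' := v_map_norm_sub_one_le σ jE hΘj hvΘ hΘlam hlam1 (pow_le_one' hπ1 _) hxθ
  have hN : Valued.v ((u + μE) * σ (u + μE) - 1) ≤ Valued.v ϖ ^ (2 * b + δ) := by
    refine (v_map_le_pow_iff jE hjv hϖ0 _ _).1 ?_
    rw [map_sub, map_one]; exact hN'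
  -- §3 on `E`
  obtain ⟨f, hσf, hf1, hfE⟩ := exists_fixed_unit_hlamE hD hd2 huu hu1 hvμE hN hb hδ
  refine ⟨f, hσf, hf1, ?_⟩
  have hfM : Valued.v (jE (μE + f * ((ϖ - σ ϖ) * ((ϖ * σ ϖ) ^ ((d - d % 2) / 2))⁻¹) * (ϖ * σ ϖ) ^ b)) ≤ Valued.v (jE ϖ) ^ (2 * b + mstarOfRecord d) :=
    (v_map_le_pow_iff jE hjv hϖ0 _ _).2 hfE
  have hsplit : μ + jE (f * ((ϖ - σ ϖ) * ((ϖ * σ ϖ) ^ ((d - d % 2) / 2))⁻¹) * (ϖ * σ ϖ) ^ b) =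
      (μ - jE μE) + jE (μE + f * ((ϖ - σ ϖ) * ((ϖ * σ ϖ) ^ ((d - d % 2) / 2))⁻¹) * (ϖ * σ ϖ) ^ b) := by rw [map_add]; ring
  rw [hsplit]
  refine (Valuation.map_add _ _ _).trans (max_le (hvθ.trans (pow_le_pow_right_of_le_one' hπ1 (by omega))) hfM)

end MSide

end Summit.HodgeConjecture.HodgeConjecture.Cruxes.H413.F0P3cDyRamDiagonalCellCleanRegime

end
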